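import Summits.BirchSwinnertonDyer.Rank1Residual.X2.TwistKodaira
import Summits.BirchSwinnertonDyer.Rank1Residual.X11b.TwistTransportTam
import HarnessLib

/-!
# Class X2, rank `1` (sub-cell X2c): transport item (d) PROVED at every odd prime — the Tamagawa
# `p`-valuation of the Heegner twist — and `X2.TwistTransportPackage` as a THEOREM
# (cell `b2b-bsdres`, unit `b2b-bsdres-eisenstein-p2`, gen 3)

HONEST FRAMING (run/shared/lean/b2b/bsd-rank1-residual/, verbatim in every file): the goal of the
cell is to DELETE the COMBINATION-SHAPED residual classes of the Birch–Swinnerton-Dyer formula for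
ALL analytic-rank `≤ 1` elliptic curves over `ℚ` — "full BSD formula for every rank `≤ 1` curve in
class `C`" assembled STRICTLY from published theorems — so that the rank-`≤ 1` remainder becomes
exactly the CONSTRUCTION-SHAPED classes, which are TYPED (missing-input `Prop`s), NOT attempted.
This is not "finishing BSD". Research routes; no claim beyond stated classes. X2c stays
CONSTRUCTION-SHAPED. Theorems only (no definition, no named fact); the content is elementary local
arithmetic (no announced result is involved).

Gen 2 reduced the transport package of X2c's class-level chain (`X2.TwistTransportPackage`,
`X2/RankOneHeegnerClass.lean`: for a CellC pair `(E,p)`, an admissible `K` with `d_K` odd and any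
globally minimal model `Wd = Cd • E^{(d_K)}`: (d) `ord_p ∏_ℓ c_ℓ(E^{(d_K)}) = ord_p ∏_ℓ c_ℓ(E)` and
(e) `ord_p u(Cd) = 0`) to the Tamagawa value (d) alone (`twistTransportPackage_of_tamagawaValue`,
p202635), and multr1-p2 proved (d) for `p ≥ 5` (`X11b.padicValNat_tamagawaProduct_twist_of_heegner`,
via Kodaira–Néron `c ≤ 4 < p` at the additive primes `ℓ ∣ d_K`). At `p = 3` — where 652 of the 705
X2c census pairs below `2·10⁴` live — `c ≤ 4` does not exclude `c = 3`; what does is the Kodaira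
TYPE: at a prime `ℓ ∣ d_K` (so `ℓ ∤ N`, `E` good at `ℓ`, and `ℓ ≥ 5` because `d_K` is odd and
`3 ∣ N` splits in `K` when `p = 3`) the twist `E^{(d_K)}` is of type `I₀*`, whose Tamagawa number
is `1, 2` or `4` (`X2/TwistKodaira.lean`). This file assembles:

* `padicValNat_localTamagawaNumber_twist_eq_of_odd` — `ord_p c_ℓ(Wd) = ord_p c_ℓ(W)` at EVERY
  prime `ℓ`, for every ODD `p` with `p ∤ d_K`: `ℓ ∣ N` — `d_K` is a square in `ℚ_ℓ`, the curves are
  `ℚ_ℓ`-isomorphic (multr1-p2's argument, Silverman VII.6 Ex. 7.6); `ℓ ∤ N`, `ℓ ∣ d_K` — type `I₀*`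
  (`ℓ ≥ 5`) or `ℓ = 3 ≠ p` (then `p ≥ 5`, `c ≤ 4`); `ℓ ∤ N d_K` — the twist is unramified at `ℓ`
  (`d_K ≡ 1 (mod 4)`), both curves are good at `ℓ`, `c = 1`.
* `padicValNat_tamagawaProduct_twist_of_heegner_of_odd` — **(d) at every odd `p ∤ d_K`**:
  `ord_p ∏_ℓ c_ℓ(Wd) = ord_p ∏_ℓ c_ℓ(W)`.
* **`twistTransportPackage_holds : X2.TwistTransportPackage`** — the package is a THEOREM (on a
  CellC pair `p ∣ N` splits in `K`, so `p ∤ d_K`); hence the class-level X2c statements of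
  `X2/RankOneHeegnerClass.lean` lose the binder `hTw`:
  `targetC_of_heegnerIndexIdentity_of_manin_of_targetB'`,
  `target_of_published_of_missingInputB_of_heegnerIndexIdentity'` — `X2.Target` ⇐ PUBLISHED facts
  + Mazur's MC at every X2b pair + the Heegner-index identity over `K` at `p ‖ N` (typed) + the
  per-pair Manin condition. Nothing else.

References: [JetchevSkinnerWan2017] §7.4.1 (eq:tamK) ("`c_ℓ(E^K) = c_ℓ(E)` for `ℓ ∣ N` split in
`K`, and `p ∤ c_ℓ(E^K) ≤ 4` at the primes `ℓ ∣ d_K`"); [SilvermanAEC2009] VII.1, VII.5–6;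
[SilvermanATAEC1994] IV.9.4 Table 4.1, Cor. IV.9.2(d); [CastellaEtAl2021] Thm. 5.3.1 (assembly shape).
-/

set_option autoImplicit false

noncomputable section

open scoped Classical MatrixGroups ModularForm

open CongruenceSubgroup IsDedekindDomain NumberField Rat.HeightOneSpectrum WeierstrassCurve
  Literature.NumberTheory.EllipticCurves Literature.NumberTheory.EllipticCurves.ModularForms
  Literature.NumberTheory.QuadraticFields Literature.NumberTheory.EllipticCurves.Rank1Residual
  Literature.NumberTheory.EllipticCurves.Rank1Residual.Typed
  Literature.NumberTheory.EllipticCurves.GreenbergVatsal2000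
  Literature.NumberTheory.EllipticCurves.Wuthrich2014
  Literature.NumberTheory.EllipticCurves.SteinWuthrich2013

namespace Summit.BirchSwinnertonDyer.Rank1Residual.X2

/-! ### Prime by prime -/

/-- **`ord_p c_ℓ(E^{(d_K)}) = ord_p c_ℓ(E)` at every prime `ℓ`, for every ODD prime `p ∤ d_K`**,
`K` imaginary quadratic with `d_K` odd in which every prime of the conductor `N` of the globally
minimal `W` splits, `Wd = Cd • W^{(d_K)}` any equation of the twist. Cases: `p ≥ 5` — multr1-p2's
`X11b.padicValNat_localTamagawaNumber_twist_eq`; `p = 3`: `ℓ ∣ N` — `d_K ∈ (ℚ_ℓ^×)²`, the curves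
are `ℚ_ℓ`-isomorphic, `c_ℓ(Wd) = c_ℓ(W)`; `ℓ ∤ N` (`W` good at `ℓ`, `c_ℓ(W) = 1`) and `ℓ ∣ d_K` —
`ℓ ≠ 2, 3` (`d_K` odd, `3 = p ∤ d_K`), `ℓ ∥ d_K` (`d_K` squarefree), type `I₀*`, `3 ∤ c_ℓ(Wd)`
(`padicValNat_localTamagawaNumber_twist_of_dvd`); `ℓ ∤ N d_K` — `d_K ≡ 1 (mod 4)`, good reduction is
preserved, `c_ℓ(Wd) = 1` (`localTamagawaNumber_twist_of_not_dvd`).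
[cite: JetchevSkinnerWan2017, §7.4.1 (eq:tamK)] [cite: SilvermanATAEC1994, IV.9.4 Table 4.1 and Cor. IV.9.2(d)] -/
theorem padicValNat_localTamagawaNumber_twist_eq_of_odd (W : WeierstrassCurve ℚ) [W.IsElliptic]
    [W.IsGloballyMinimal] (p : ℕ) [Fact p.Prime] (hp2 : p ≠ 2) (K : Type) [Field K] [NumberField K]
    (hK : IsImaginaryQuadratic K) (hodd : Odd (NumberField.discr K))
    (hpd : ¬ (p : ℤ) ∣ NumberField.discr K) (hH : SatisfiesHeegnerHypothesis (W.conductorNorm ℤ) K)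
    {Wd : WeierstrassCurve ℚ} [Wd.IsElliptic] (Cd : VariableChange ℚ)
    (hWd : Cd • W.quadraticTwist (NumberField.discr K : ℚ) = Wd) (ℓ : ℕ) [Fact ℓ.Prime] :
    padicValNat p ((Wd.baseChange ℚ_[ℓ]).localTamagawaNumber ℤ_[ℓ]) =
      padicValNat p ((W.baseChange ℚ_[ℓ]).localTamagawaNumber ℤ_[ℓ]) := by
  by_cases hp5 : 5 ≤ p
  · exact X11b.padicValNat_localTamagawaNumber_twist_eq W p hp5 K hK hH Cd hWd ℓ
  have hpP : p.Prime := Fact.out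
  have hℓP : ℓ.Prime := Fact.out
  have hp3 : p = 3 := by
    have h2 := hpP.two_le
    interval_cases p
    · exact absurd rfl hp2
    · rfl
    · exact absurd hpP (by decide)
  set d : ℤ := NumberField.discr K with hd_def
  have hdZ : d ≠ 0 := NumberField.discr_ne_zero K
  have hD0 : (d : ℚ) ≠ 0 := by exact_mod_cast hdZ
  haveI : (W.baseChange ℚ_[ℓ]).IsElliptic :=
    inferInstanceAs (W.map (algebraMap ℚ ℚ_[ℓ])).IsElliptic
  haveI : (Wd.baseChange ℚ_[ℓ]).IsElliptic :=
    inferInstanceAs (Wd.map (algebraMap ℚ ℚ_[ℓ])).IsElliptic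
  haveI : (W.quadraticTwist (d : ℚ)).IsElliptic := W.isElliptic_quadraticTwist hD0
  by_cases hℓN : ℓ ∣ W.conductorNorm ℤ
  · -- `ℓ ∣ N`: `d_K` is a square in `ℚ_ℓ`, the two curves are `ℚ_ℓ`-isomorphic
    obtain ⟨θ, hθ⟩ := X11b.isSquare_discr_padic_of_heegner K hK hH ℓ hℓN
    have hθ0 : θ ≠ 0 := by
      rintro rfl
      exact (map_ne_zero (algebraMap ℚ ℚ_[ℓ])).mpr hD0 (hθ.trans (mul_zero 0))
    obtain ⟨C, hC⟩ := (W.baseChange ℚ_[ℓ]).exists_variableChange_smul_eq_quadraticTwist_sq hθ0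
    have h1 : (W.quadraticTwist (d : ℚ)).baseChange ℚ_[ℓ] = C • W.baseChange ℚ_[ℓ] := by
      rw [hC, baseChange, baseChange, map_quadraticTwist, hθ, sq]
    have hYX : Wd.baseChange ℚ_[ℓ] = (Cd.map (algebraMap ℚ ℚ_[ℓ]) * C) • W.baseChange ℚ_[ℓ] := by
      rw [← hWd, WeierstrassCurve.VariableChange.baseChange_smul_eq (W.quadraticTwist (d : ℚ)) Cd ℚ_[ℓ],
        h1, mul_smul]
    rw [hYX, localTamagawaNumber_variableChange_holds ℤ_[ℓ] (W.baseChange ℚ_[ℓ])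
      (Cd.map (algebraMap ℚ ℚ_[ℓ]) * C)]
  · -- `ℓ ∤ N`: `W` is good at `ℓ`, `c_ℓ(W) = 1`
    have hgood : W.HasGoodReductionAtPrime ℓ := by
      by_contra h
      exact hℓN ((W.dvd_conductorNorm_iff_not_hasGoodReductionAtPrime ℓ).mpr h)
    have hcW : (W.baseChange ℚ_[ℓ]).localTamagawaNumber ℤ_[ℓ] = 1 := by
      haveI : ((W.baseChange ℚ_[ℓ]).minimal ℤ_[ℓ]).HasGoodReduction ℤ_[ℓ] := hgood
      exact localTamagawaNumber_eq_one_of_hasGoodReduction_holds ℤ_[ℓ] _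
    rw [hcW, padicValNat_one_right]
    by_cases hℓd : (ℓ : ℤ) ∣ d
    · -- `ℓ ∣ d_K`: `ℓ ≥ 5`, `ℓ ∥ d_K`, Kodaira type `I₀*`
      have hℓ2 : ℓ ≠ 2 := by
        rintro rfl
        obtain ⟨m, hm⟩ := hodd
        omega
      have hℓ3 : ℓ ≠ 3 := by
        rintro rfl
        exact hpd (by rw [hp3]; exact hℓd)
      have hℓ5 : 5 ≤ ℓ := by
        have h2 := hℓP.two_le
        by_contra hlt
        interval_cases ℓ
        · exact hℓ2 rfl
        · exact hℓ3 rfl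
        · exact absurd hℓP (by decide)
      have hsq : ¬ (ℓ : ℤ) ^ 2 ∣ d := by
        intro h
        have hsf := squarefree_discr_of_odd hK hodd
        have hunit := hsf (ℓ : ℤ) (by rw [← sq]; exact h)
        rw [Int.isUnit_iff_natAbs_eq, Int.natAbs_natCast] at hunit
        exact hℓP.one_lt.ne' hunit
      exact padicValNat_localTamagawaNumber_twist_of_dvd W p hp2 ℓ hℓ5 hdZ hℓd hsq hgood Cd hWd
    · -- `ℓ ∤ N d_K`: unramified twist, good reduction preserved, `c_ℓ(Wd) = 1`
      have h4 : d = 4 * (d / 4) + 1 := by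
        rcases Quadratic.isFundamentalDiscriminant_discr (K := K) hK.1 with ⟨h1, -, -⟩ | ⟨h4, -, -⟩
        · omega
        · exfalso
          obtain ⟨k, hk⟩ := h4
          obtain ⟨m, hm⟩ := hodd
          omega
      rw [localTamagawaNumber_twist_of_not_dvd W ℓ h4 hℓd hgood Cd hWd, padicValNat_one_right]

/-! ### The Tamagawa value (d) at every odd prime -/

/-- `ord_p` of a finite product of non-zero naturals is the sum of the `ord_p`. [folklore] -/
private theorem padicValNat_finset_prod' (p : ℕ) [Fact p.Prime] {ι : Type*} (s : Finset ι)
    (f : ι → ℕ) (hf : ∀ i ∈ s, f i ≠ 0) :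
    padicValNat p (∏ i ∈ s, f i) = ∑ i ∈ s, padicValNat p (f i) := by
  induction s using Finset.induction_on with
  | empty => simp
  | insert a s ha ih =>
    rw [Finset.prod_insert ha, Finset.sum_insert ha,
      padicValNat.mul (hf a (Finset.mem_insert_self a s))
        (Finset.prod_ne_zero_iff.mpr fun i hi => hf i (Finset.mem_insert_of_mem hi)),
      ih fun i hi => hf i (Finset.mem_insert_of_mem hi)]

/-- **Transport (d) at every odd prime: `ord_p ∏_ℓ c_ℓ(E^{(d_K)}) = ord_p ∏_ℓ c_ℓ(E)`** for
`p ≠ 2`, `p ∤ d_K`, `K` imaginary quadratic with `d_K` odd satisfying the Heegner hypothesis for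
the conductor of the globally minimal `W`, and ANY equation `Wd = Cd • W^{(d_K)}` of the twist.
Both Tamagawa products are finite products of `ℓ`-adic local Tamagawa numbers over the union of the
bad places (`tamagawaProduct_eq_prod`), compared prime by prime
(`padicValNat_localTamagawaNumber_twist_eq_of_odd`). Extends multr1-p2's
`X11b.padicValNat_tamagawaProduct_twist_of_heegner` (`p ≥ 5`) to `p = 3`.
[cite: JetchevSkinnerWan2017, §7.4.1 (eq:tamK) (pp. 29–31)] [cite: SilvermanATAEC1994, Cor. IV.9.2(d) and Table 4.1] -/
theorem padicValNat_tamagawaProduct_twist_of_heegner_of_odd (W : WeierstrassCurve ℚ) [W.IsElliptic]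
    [W.IsGloballyMinimal] (p : ℕ) [Fact p.Prime] (hp2 : p ≠ 2) (K : Type) [Field K] [NumberField K]
    (hK : IsImaginaryQuadratic K) (hodd : Odd (NumberField.discr K))
    (hpd : ¬ (p : ℤ) ∣ NumberField.discr K) (hH : SatisfiesHeegnerHypothesis (W.conductorNorm ℤ) K)
    {Wd : WeierstrassCurve ℚ} [Wd.IsElliptic] (Cd : VariableChange ℚ)
    (hWd : Cd • W.quadraticTwist (NumberField.discr K : ℚ) = Wd) :
    padicValNat p Wd.tamagawaProduct = padicValNat p W.tamagawaProduct := by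
  have hfW : (W.badPlaces ℤ).Finite := W.finite_badPlaces_holds ℤ
  have hfWd : (Wd.badPlaces ℤ).Finite := Wd.finite_badPlaces_holds ℤ
  set s : Finset (IsDedekindDomain.HeightOneSpectrum ℤ) := hfW.toFinset ∪ hfWd.toFinset with hs
  have hsW : ∀ v, ¬ W.HasGoodReductionAt v → v ∈ s := fun v hv ↦
    Finset.mem_union_left _ (by rw [Set.Finite.mem_toFinset, mem_badPlaces_iff]; exact hv)
  have hsWd : ∀ v, ¬ Wd.HasGoodReductionAt v → v ∈ s := fun v hv ↦
    Finset.mem_union_right _ (by rw [Set.Finite.mem_toFinset, mem_badPlaces_iff]; exact hv)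
  rw [tamagawaProduct_eq_prod W s hsW, tamagawaProduct_eq_prod Wd s hsWd,
    padicValNat_finset_prod' p s _ fun v _ ↦ ?_, padicValNat_finset_prod' p s _ fun v _ ↦ ?_]
  · refine Finset.sum_congr rfl fun v _ ↦ ?_
    haveI := Fact.mk (primesEquiv v).2
    exact padicValNat_localTamagawaNumber_twist_eq_of_odd W p hp2 K hK hodd hpd hH Cd hWd
      (primesEquiv v)
  · haveI := Fact.mk (primesEquiv v).2
    haveI : (Wd.baseChange ℚ_[primesEquiv v]).IsElliptic :=
      inferInstanceAs (Wd.map (algebraMap ℚ ℚ_[primesEquiv v])).IsElliptic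
    exact localTamagawaNumber_padic_ne_zero_holds (primesEquiv v) _
  · haveI := Fact.mk (primesEquiv v).2
    haveI : (W.baseChange ℚ_[primesEquiv v]).IsElliptic :=
      inferInstanceAs (W.map (algebraMap ℚ ℚ_[primesEquiv v])).IsElliptic
    exact localTamagawaNumber_padic_ne_zero_holds (primesEquiv v) _

/-! ### The transport package is a theorem -/

/-- **`X2.TwistTransportPackage` holds.** On a CellC pair `p` is odd and multiplicative, so
`p ∣ N` splits in the Heegner field `K` and `p ∤ d_K` (`not_dvd_discr_of_split`); item (d) is
`padicValNat_tamagawaProduct_twist_of_heegner_of_odd`, item (e) is gen 2's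
`padicValRat_u_eq_zero_of_smul_quadraticTwist` (through `twistTransportPackage_of_tamagawaValue`).
[cite: JetchevSkinnerWan2017, §7.4.1 (eq:tamK)] [cite: SilvermanAEC2009, VII.1 Prop. 1.3(b)] -/
theorem twistTransportPackage_holds : TwistTransportPackage :=
  twistTransportPackage_of_tamagawaValue fun W _ _ p _ K _ _ Wd _ _ Cd hc hK hodd hHN hWd => by
    have hp : p.Prime := Fact.out
    have hp2 : p ≠ 2 := hc.2.1
    have hmult : W.HasMultiplicativeReductionAtPrime p := hc.2.2.2
    have hpN : p ∣ W.conductorNorm ℤ :=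
      (W.dvd_conductorNorm_iff_not_hasGoodReductionAtPrime p).mpr
        (WeierstrassCurve.HasMultiplicativeReduction.not_hasGoodReduction (R := ℤ_[p]) hmult)
    have hsplit : SatisfiesHeegnerHypothesis p K := SatisfiesHeegnerHypothesis.of_dvd hpN hHN
    have hpd : ¬ (p : ℤ) ∣ NumberField.discr K := not_dvd_discr_of_split hK hp hp2 hsplit
    exact padicValNat_tamagawaProduct_twist_of_heegner_of_odd W p hp2 K hK hodd hpd hHN Cd hWd

/-! ### The class-level X2c statements without the transport binder -/

/-- **Sub-cell X2c's target from the typed input over `K`, the per-pair Manin condition and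
sub-cell X2b's target** — gen 2's `targetC_of_heegnerIndexIdentity_of_manin_of_targetB` with the
transport package DISCHARGED (`twistTransportPackage_holds`). [cite: CastellaEtAl2021, Thm. 5.3.1]
[cite: Miller2011LMS, Def. 1.1] -/
theorem targetC_of_heegnerIndexIdentity_of_manin_of_targetB'
    (hGV : lambdaMu_multiplicative_of_gvPar) (hWu : thm16_charIdeal_dvd_multiplicative_of_reducible)
    (hJs : thm61_splitMultiplicative) (hJn : thm61_nonsplitMultiplicative)
    (hHs : exists_isSplitMultCanonical) (hHn : exists_isMultCanonical)
    (hpar : nonempty_modularParametrizationData)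
    (hGS : ∀ (W : WeierstrassCurve ℚ) [W.IsElliptic] [W.IsGloballyMinimal] (p : ℕ) [Fact p.Prime],
      greenberg_stevens (W := W) (p := p))
    (hGZ : ∀ (N : ℕ) [NeZero N] (W : WeierstrassCurve ℚ) (K : Type) [Field K] [NumberField K],
      gross_zagier N W K)
    (hKo : ∀ (N : ℕ) [NeZero N] (W : WeierstrassCurve ℚ) (K : Type) [Field K] [NumberField K],
      kolyvagin N W K)
    (hHP : ∀ (N : ℕ) [NeZero N] (W : WeierstrassCurve ℚ) (K : Type) [Field K] [NumberField K],
      heegnerPointComplex_mem_range_map N W K)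
    (hGZK : rank_eq_analyticRank_of_analyticRank_le_one) (hnf : exists_isNewformOf)
    (hHL : HoffsteinLuo1997_exists_twist_L_one_ne_zero) (hHI : HeegnerIndexIdentity)
    (hMan : ∀ (W : WeierstrassCurve ℚ) [W.IsElliptic] [W.IsGloballyMinimal] (p : ℕ) [Fact p.Prime],
      CellC W p → HasPrimeToManinDatum W p)
    (hB : TargetB) : TargetC :=
  targetC_of_heegnerIndexIdentity_of_manin_of_targetB hGV hWu hJs hJn hHs hHn hpar hGS hGZ hKo hHP
    hGZK hnf hHL twistTransportPackage_holds hHI hMan hB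

/-- **What remains of class X2 in the kernel after gen 3**: `X2.Target` follows from the PUBLISHED
named facts (binders), Mazur's main conjecture at every X2b pair (`MissingInputB` — EXACT by
`X2/RankZeroExact.lean`), the Heegner-index identity over `K` at `p ‖ N` (`HeegnerIndexIdentity`,
typed: Keller–Yin PRE + the located links, `X2/RankOneLinks.lean`), and the per-pair Manin
condition (`HasPrimeToManinDatum`). The transport package of gen 2's
`target_of_published_of_missingInputB_of_heegnerIndexIdentity` is now a theorem.
[cite: Miller2011LMS, Def. 1.1 and §1] [cite: CastellaEtAl2021, Thm. 5.3.1] -/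
theorem target_of_published_of_missingInputB_of_heegnerIndexIdentity'
    (hGV : lambdaMu_multiplicative_of_gvPar) (hWu : thm16_charIdeal_dvd_multiplicative_of_reducible)
    (hJs : thm61_splitMultiplicative) (hJn : thm61_nonsplitMultiplicative)
    (hHs : exists_isSplitMultCanonical) (hHn : exists_isMultCanonical)
    (hpar : nonempty_modularParametrizationData)
    (hGS : ∀ (W : WeierstrassCurve ℚ) [W.IsElliptic] [W.IsGloballyMinimal] (p : ℕ) [Fact p.Prime],
      greenberg_stevens (W := W) (p := p))
    (hGZ : ∀ (N : ℕ) [NeZero N] (W : WeierstrassCurve ℚ) (K : Type) [Field K] [NumberField K],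
      gross_zagier N W K)
    (hKo : ∀ (N : ℕ) [NeZero N] (W : WeierstrassCurve ℚ) (K : Type) [Field K] [NumberField K],
      kolyvagin N W K)
    (hHP : ∀ (N : ℕ) [NeZero N] (W : WeierstrassCurve ℚ) (K : Type) [Field K] [NumberField K],
      heegnerPointComplex_mem_range_map N W K)
    (hGZK : rank_eq_analyticRank_of_analyticRank_le_one) (hnf : exists_isNewformOf)
    (hHL : HoffsteinLuo1997_exists_twist_L_one_ne_zero)
    (hMan : ∀ (W : WeierstrassCurve ℚ) [W.IsElliptic] [W.IsGloballyMinimal] (p : ℕ) [Fact p.Prime],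
      CellC W p → HasPrimeToManinDatum W p)
    (hmissB : ∀ (W : WeierstrassCurve ℚ) [W.IsElliptic] [W.IsGloballyMinimal] (p : ℕ) [Fact p.Prime],
      CellB W p → MissingInputB W p)
    (hHI : HeegnerIndexIdentity) : Target :=
  target_of_published_of_missingInputB_of_heegnerIndexIdentity hGV hWu hJs hJn hHs hHn hpar hGS hGZ
    hKo hHP hGZK hnf hHL twistTransportPackage_holds hMan hmissB hHI

end Summit.BirchSwinnertonDyer.Rank1Residual.X2

end
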